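import Mathlib
import HarnessLib
import Literature.AlgebraicGeometry.HyperbolicPolynomials.SpectrahedralShadow
import Summits.ValiantsHypothesis.ValiantsHypothesis.Theorems.PermanentalConesHyperbolicVPShadowStubSpectrahedronOfSymmDetIdentity

/-!
# ValiantsHypothesis / PermanentalCones — `HyperbolicVPShadow`, stub O₁ʰ

Route `PermanentalCones`, item `stmt-ValiantsHypothesis-8655` (crux `HyperbolicVPShadow`), line
`birth`, stub `stub_oshimeFamily1h_spectrahedron` (the *homogenised* pencil of Oshime's family (1)
of non-symmetrisable real-spectrum `3 × 3` pencils has a size-`3` spectrahedral cone).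

Oshime (J. Math. Kyoto Univ. 31 (1991), Thm 4.7) lists, among the uniformly real-diagonalisable
`3 × 3` families that are not simultaneously symmetrisable, family (1)
`⟨A, B, C_a⟩ = ⟨diag (1, 0, 0), E₁₂ + E₂₁, !![0, a, 1; -a, 0, 0; 1, 0, 0]⟩` (`0 < a < 1`).
For every real `a` with `a² ≤ 1` the homogenised four-variable pencil
`P x = x₀·1 + x₁ A + x₂ B + x₃ C_a` satisfies the *real symmetric* determinantal identity

  `det (P x + τ·1) = t³ + x₁ t² − x₂² t − (1 − a²) x₃² t = det (L x + τ·1)`, `t = τ + x₀`,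
  `L x = !![x₀, 0, x₂; 0, x₀, c x₃; x₂, c x₃, x₀ + x₁]`, `c = √(1 − a²)`

(a polynomial identity in `x₀, x₁, x₂, x₃, τ` modulo `c² = 1 − a²`, checked by
`linear_combination`). Feeding it to `stub_spectrahedron_of_symmDetIdentity` (with `n = 4`,
`N = 3`) shows that the closed nonnegative-spectrum cone `{x : ∀ τ > 0, det (P x + τ·1) ≠ 0}` is
the spectrahedron `{x : L x ⪰ 0}` of size `3`.

No definitions are introduced: the matrices are written out as literals, the two pencils are
`Fintype.linearCombination ℝ ![…]`.
-/

-- `<Problem> = <Summit>` for this single-conjunct summit (lakefile sets the same option tree-wide).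
set_option linter.dupNamespace false

namespace Summit.ValiantsHypothesis.ValiantsHypothesis.Theorems

open Matrix

/-! ## The two pencils -/

/-- The homogenised family-(1) pencil as a linear map:
`Fintype.linearCombination ℝ ![1, A, B, C_a] x = x₀·1 + x₁ A + x₂ B + x₃ C_a`. [folklore] -/
theorem permanentalCones_oshime1h_P_apply (a : ℝ) (x : Fin 4 → ℝ) :
    Fintype.linearCombination ℝ ![(1 : Matrix (Fin 3) (Fin 3) ℝ),
        !![(1 : ℝ), 0, 0; 0, 0, 0; 0, 0, 0], !![(0 : ℝ), 1, 0; 1, 0, 0; 0, 0, 0],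
        !![(0 : ℝ), a, 1; -a, 0, 0; 1, 0, 0]] x =
      x 0 • (1 : Matrix (Fin 3) (Fin 3) ℝ) + x 1 • !![(1 : ℝ), 0, 0; 0, 0, 0; 0, 0, 0] +
        x 2 • !![(0 : ℝ), 1, 0; 1, 0, 0; 0, 0, 0] +
        x 3 • !![(0 : ℝ), a, 1; -a, 0, 0; 1, 0, 0] := by
  rw [Fintype.linearCombination_apply, Fin.sum_univ_four]
  rfl

/-- Entries of `P x + τ·1 = !![τ + x₀ + x₁, x₂ + a x₃, x₃; x₂ − a x₃, τ + x₀, 0; x₃, 0, τ + x₀]`.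
[folklore] -/
theorem permanentalCones_oshime1h_P_entries (a : ℝ) (x : Fin 4 → ℝ) (τ : ℝ) :
    x 0 • (1 : Matrix (Fin 3) (Fin 3) ℝ) + x 1 • !![(1 : ℝ), 0, 0; 0, 0, 0; 0, 0, 0] +
        x 2 • !![(0 : ℝ), 1, 0; 1, 0, 0; 0, 0, 0] +
        x 3 • !![(0 : ℝ), a, 1; -a, 0, 0; 1, 0, 0] + τ • (1 : Matrix (Fin 3) (Fin 3) ℝ) =
      !![τ + x 0 + x 1, x 2 + a * x 3, x 3; x 2 - a * x 3, τ + x 0, 0; x 3, 0, τ + x 0] := by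
  ext i j
  fin_cases i <;> fin_cases j <;> simp <;> ring

/-- The symmetric certificate pencil as a linear map:
`Fintype.linearCombination ℝ ![1, E₃₃, E₁₃ + E₃₁, c (E₂₃ + E₃₂)] x =
!![x₀, 0, x₂; 0, x₀, c x₃; x₂, c x₃, x₀ + x₁]`. [folklore] -/
theorem permanentalCones_oshime1h_L_apply (c : ℝ) (x : Fin 4 → ℝ) :
    Fintype.linearCombination ℝ ![(1 : Matrix (Fin 3) (Fin 3) ℝ),
        !![(0 : ℝ), 0, 0; 0, 0, 0; 0, 0, 1], !![(0 : ℝ), 0, 1; 0, 0, 0; 1, 0, 0],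
        !![(0 : ℝ), 0, 0; 0, 0, c; 0, c, 0]] x =
      !![x 0, 0, x 2; 0, x 0, c * x 3; x 2, c * x 3, x 0 + x 1] := by
  ext i j
  rw [Fintype.linearCombination_apply, Fin.sum_univ_four]
  fin_cases i <;> fin_cases j <;> simp <;> ring

/-- Every `L x = !![x₀, 0, x₂; 0, x₀, c x₃; x₂, c x₃, x₀ + x₁]` is symmetric. [folklore] -/
theorem permanentalCones_oshime1h_L_isSymm (c : ℝ) (x : Fin 4 → ℝ) :
    (!![x 0, 0, x 2; 0, x 0, c * x 3; x 2, c * x 3, x 0 + x 1] :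
      Matrix (Fin 3) (Fin 3) ℝ).IsSymm :=
  Matrix.IsSymm.ext fun i j => by fin_cases i <;> fin_cases j <;> simp

/-! ## The symmetric determinantal certificate -/

/-- The certificate: if `c² = 1 − a²` then
`det !![τ + x₀ + x₁, x₂ + a x₃, x₃; x₂ − a x₃, τ + x₀, 0; x₃, 0, τ + x₀] = det (L x + τ·1)`
(both sides equal `t³ + x₁ t² − x₂² t − (1 − a²) x₃² t` with `t = τ + x₀`). [folklore] -/
theorem permanentalCones_oshime1h_det_eq (a c : ℝ) (hc : c ^ 2 = 1 - a ^ 2) (x : Fin 4 → ℝ)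
    (τ : ℝ) :
    (!![τ + x 0 + x 1, x 2 + a * x 3, x 3; x 2 - a * x 3, τ + x 0, 0; x 3, 0, τ + x 0] :
        Matrix (Fin 3) (Fin 3) ℝ).det =
      ((!![x 0, 0, x 2; 0, x 0, c * x 3; x 2, c * x 3, x 0 + x 1] : Matrix (Fin 3) (Fin 3) ℝ) +
        τ • (1 : Matrix (Fin 3) (Fin 3) ℝ)).det := by
  simp only [Fin.isValue, det_fin_three, Matrix.add_apply, of_apply, cons_val', cons_val_zero,
    cons_val_fin_one, Matrix.smul_apply, one_apply_eq, smul_eq_mul, mul_one, cons_val_one,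
    cons_val, ne_eq, Fin.reduceEq, not_false_eq_true, one_apply_ne, mul_zero, add_zero, zero_ne_one,
    one_ne_zero]
  linear_combination ((τ + x 0) * x 3 ^ 2) * hc

/-! ## The stub -/

/-- **Stub O₁ʰ (the homogenised Oshime family (1) has size-`3` spectrahedral cones).** For every
real `a` with `a² ≤ 1`, the closed nonnegative-spectrum cone
`{x : ∀ τ > 0, det (x₀·1 + x₁ A + x₂ B + x₃ C_a + τ·1) ≠ 0}` of the homogenised pencil of
`⟨A, B, C_a⟩ = ⟨diag (1, 0, 0), E₁₂ + E₂₁, !![0, a, 1; -a, 0, 0; 1, 0, 0]⟩`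
(Oshime 1991, Thm 4.7, family (1)) is a spectrahedron of size `3`: by the real symmetric
certificate `L x = x₀·1 + x₁ E₃₃ + x₂ (E₁₃ + E₃₁) + √(1 − a²) x₃ (E₂₃ + E₃₂)`,
`det (P x + τ·1) = det (L x + τ·1)`, and `stub_spectrahedron_of_symmDetIdentity`. [folklore] -/
theorem stub_oshimeFamily1h_spectrahedron :
    ∀ a : ℝ, a ^ 2 ≤ 1 →
      Literature.AlgebraicGeometry.HyperbolicPolynomials.IsSpectrahedralShadowOfSize
        {x : Fin 4 → ℝ | ∀ τ : ℝ, 0 < τ →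
          (x 0 • (1 : Matrix (Fin 3) (Fin 3) ℝ) + x 1 • !![(1 : ℝ), 0, 0; 0, 0, 0; 0, 0, 0] +
            x 2 • !![(0 : ℝ), 1, 0; 1, 0, 0; 0, 0, 0] +
            x 3 • !![(0 : ℝ), a, 1; -a, 0, 0; 1, 0, 0] +
            τ • (1 : Matrix (Fin 3) (Fin 3) ℝ)).det ≠ 0} 3 := by
  intro a ha
  -- the real constant `c = √(1 − a²)` of the certificate, with `c² = 1 − a²`
  obtain ⟨c, hc⟩ : ∃ c : ℝ, c ^ 2 = 1 - a ^ 2 := ⟨Real.sqrt (1 - a ^ 2), Real.sq_sqrt (by linarith)⟩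
  -- the determinantal identity `det (P x + τ·1) = det (L x + τ·1)`
  have hdet : ∀ (x : Fin 4 → ℝ) (τ : ℝ),
      (Fintype.linearCombination ℝ
          ![(1 : Matrix (Fin 3) (Fin 3) ℝ), !![(1 : ℝ), 0, 0; 0, 0, 0; 0, 0, 0],
            !![(0 : ℝ), 1, 0; 1, 0, 0; 0, 0, 0], !![(0 : ℝ), a, 1; -a, 0, 0; 1, 0, 0]] x +
          τ • (1 : Matrix (Fin 3) (Fin 3) ℝ)).det =
        (Fintype.linearCombination ℝ
          ![(1 : Matrix (Fin 3) (Fin 3) ℝ), !![(0 : ℝ), 0, 0; 0, 0, 0; 0, 0, 1],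
            !![(0 : ℝ), 0, 1; 0, 0, 0; 1, 0, 0], !![(0 : ℝ), 0, 0; 0, 0, c; 0, c, 0]] x +
          τ • (1 : Matrix (Fin 3) (Fin 3) ℝ)).det := fun x τ => by
    rw [permanentalCones_oshime1h_P_apply, permanentalCones_oshime1h_P_entries,
      permanentalCones_oshime1h_L_apply]
    exact permanentalCones_oshime1h_det_eq a c hc x τ
  -- stub S turns the identity into a size-`3` spectrahedral description
  have h := stub_spectrahedron_of_symmDetIdentity 4 3 _ _
    (fun x => (permanentalCones_oshime1h_L_apply c x).symm ▸
      permanentalCones_oshime1h_L_isSymm c x)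
    hdet
  simpa only [permanentalCones_oshime1h_P_apply] using h

end Summit.ValiantsHypothesis.ValiantsHypothesis.Theorems
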